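import Literature.MathematicalPhysics.QuantumLattice.FreeFermionSectorEnergyDeviation
import Literature.MathematicalPhysics.QuantumLattice.HubbardLangerMattisFourByFour
import Literature.MathematicalPhysics.QuantumLattice.HubbardWave0RepulsiveProofs
import HarnessLib

/-!
# Fermi-surface smearing of a lattice Fermi gas equals its kinetic energy above the bathtub floor

Family `hubbard` / trunk T-QLATTICE. For the free nearest-neighbour band `ε_L(k) = -2(cos p₁ + cos p₂)`
of the fermionic torus `(ℤ/Lℤ)²` (`L ≥ 3`, `H₀ = hubbardTorus 2 L 1 0 = Σ_{kσ} ε_L(k) n_{kσ}`), any real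
"Fermi level" `μ` and ANY `N`-particle vector `ψ` with Bloch occupations
`x_{kσ} = Re⟨ψ, n_{kσ} ψ⟩ ∈ [0, ‖ψ‖²]` (`occ`), the **Fermi-surface smearing functional**

  `W_μ(ψ) := Σ_{kσ} [ (μ - ε_k)₊ (‖ψ‖² - x_{kσ}) + (ε_k - μ)₊ x_{kσ} ]`     (`smearing`)

— holes below `μ` and particles above `μ`, each weighted by its distance `|ε_k - μ|` to the Fermi
level — satisfies the **identity** (`smearing_eq`)

  `W_μ(ψ) = Re⟨ψ, H₀ ψ⟩ - (μ N + 2 Σ_k min(ε_k - μ, 0)) ‖ψ‖²`,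

i.e. it IS the kinetic energy measured from the bathtub value `μN + 2Σ_k min(ε_k - μ, 0)` (the free
`N`-particle ground energy when `μ` is a Fermi level of the `N`-particle problem; Lieb–Loss, *Analysis*,
Thm 1.14). Consequences (Markov's inequality on the nonnegative terms, `markov`): for `δ > 0`, the number
of holes in levels `ε_k ≤ μ - δ` plus the number of particles in levels `ε_k ≥ μ + δ` is at most
`W_μ(ψ)/δ`. Hence every certified CEILING on the kinetic energy of a state (e.g. a Hubbard ground state,
from an energy window and `U⟨D⟩ ≥ 0` or a double-occupancy floor) is a certified bound on how far its
momentum distribution `n(k)` may deviate from the free Fermi step — the broadening of `n(k)` by the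
interaction that determinant QMC measures (Varney et al. 2009 §3) and optical-lattice band mapping images.

§2 specialises to the `4 × 4` torus at `μ = 0` (the Fermi level of every filling `10 ≤ N ≤ 22`):
the sixteen levels are `-4` (Γ), `-2` (×4), `0` (×6), `2` (×4), `4` (Q = (π,π)) (`torusBand_four_mem`),
the bathtub value is `-24` (`bathtub_four_zero`), so `W_0(ψ) = Re⟨ψ, H₀ψ⟩ + 24‖ψ‖²`
(`smearing_zero_four_eq`); the named observables `nAbove` (electrons in the five levels `ε > 0`),
`holesBelow` (holes in the five levels `ε < 0`), `nInside` (electrons in the eleven levels `ε ≤ 0`, the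
closed free Fermi sea plus its open shell) obey `2(holesBelow + nAbove) ≤ W_0 ≤ 4(holesBelow + nAbove)`
(`two_mul_dev_le_smearing_zero`, `smearing_zero_le_four_mul_dev`), `4(h_Γ + n_Q) ≤ W_0`
(`four_mul_corner_le_smearing_zero`), `nInside + nAbove = N‖ψ‖²` (`nInside_add_nAbove`).

Sources: E. H. Lieb, M. Loss, *Analysis*, 2nd ed. (AMS 2001), Theorem 1.14 (bathtub principle);
H. Tasaki, *Physics and Mathematics of Quantum Many-Body Systems* (Springer 2020), §2.1 (variational
bookkeeping); C. N. Varney et al., Phys. Rev. B 80 (2009) 075116, §3 (momentum distribution of the 2D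
Hubbard model by DQMC: "interactions broaden the U = 0 Fermi surface considerably"). Folklore
finite-dimensional statements; two bookkeeping definitions (`occ`, `smearing`) and three named `4 × 4` sums;
no named facts, no sorry.

Relation to the tree: `FreeFermionSectorEnergyDeviation.lean` bounds the weaker smearing form
`Σ_k |ε_k - ε_F| x_k(1 - x_k)` and `FreeFermionSectorDeviationExact.lean` proves the same exact bookkeeping
relative to a separating Fermi SET `F` (`sum_abs_sub_mul_deviation_eq`, needs `Σ_k x_k = |F|`; applied to spin
`↑` on the `S^z = 0` sector against `minEnergyOn`). Here the bookkeeping is relative to a Fermi LEVEL `μ`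
(any real `μ`, no Fermi set, no sector hypothesis beyond the particle number, both spins, explicit constant
`μN + 2Σ_k min(ε_k - μ, 0)`), followed by the Markov corollaries and the `4 × 4` tables that certified
kinetic-energy windows of Hubbard ground states are fed through (R2 ladder rows).

## Mathlib / tree search
Tree: `sum_abs_sub_mul_deviation_eq`, `sum_abs_sub_fermiLevel_mul_le_energy_excess` (see above),
`momentumNumber`, `hubbardTorus_zero_eq_sum_momentumNumber`, `totalNumber_eq_sum_momentumNumber`,
`LiebTwo.isNParticle_iff_totalNumber`, `re_expect_momentumNumber_mem_Icc`, `torusBand`, `torusBand_zero`,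
`cosFour`, `cos_latticeMomentum_four`. Mathlib: `Finset.sum_filter`, `Finset.sum_union`,
`Finset.sum_le_sum_of_subset_of_nonneg`, `Finset.sum_filter_add_sum_filter_not`.
-/

noncomputable section

namespace Literature.MathematicalPhysics.QuantumLattice.FermiSmearing

open Matrix Finset Literature.Probability.LatticeModels
open Literature.MathematicalPhysics.QuantumLattice
open Literature.MathematicalPhysics.QuantumLattice.LangerMattis (cosFour cos_latticeMomentum_four)

variable {L : ℕ} [NeZero L]

/-! ### §1 The smearing functional on `(ℤ/Lℤ)²` -/

/-- The Bloch occupation `x_{kσ}(ψ) = Re⟨ψ, n_{kσ} ψ⟩` of the mode `(k, σ)`.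
[cite: VarneyEtAl2009, §3] -/
def occ (k : TorusSite 2 L) (σ : Fin 2) (ψ : Fock (Orb (FermionTorus 2 L))) : ℝ :=
  (star ψ ⬝ᵥ (momentumNumber k σ *ᵥ ψ)).re

/-- `0 ≤ x_{kσ}(ψ)`. [cite: VarneyEtAl2009, §3] -/
theorem occ_nonneg (k : TorusSite 2 L) (σ : Fin 2) (ψ : Fock (Orb (FermionTorus 2 L))) :
    0 ≤ occ k σ ψ :=
  (re_expect_momentumNumber_mem_Icc k σ ψ).1

/-- `x_{kσ}(ψ) ≤ ‖ψ‖²` (Pauli). [cite: VarneyEtAl2009, §3] -/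
theorem occ_le (k : TorusSite 2 L) (σ : Fin 2) (ψ : Fock (Orb (FermionTorus 2 L))) :
    occ k σ ψ ≤ (star ψ ⬝ᵥ ψ).re :=
  (re_expect_momentumNumber_mem_Icc k σ ψ).2

/-- **The Fermi-surface smearing functional at Fermi level `μ`**:
`W_μ(ψ) = Σ_{kσ} [(μ - ε_k)₊ (‖ψ‖² - x_{kσ}) + (ε_k - μ)₊ x_{kσ}]` — holes below and particles above
the level `μ`, weighted by their distance to it. [cite: LiebLoss2001, Theorem 1.14] -/
def smearing (μ : ℝ) (ψ : Fock (Orb (FermionTorus 2 L))) : ℝ :=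
  ∑ k : TorusSite 2 L, ∑ σ : Fin 2,
    (max (μ - torusBand L k) 0 * ((star ψ ⬝ᵥ ψ).re - occ k σ ψ) +
      max (torusBand L k - μ) 0 * occ k σ ψ)

/-- Every term of `W_μ` is nonnegative. [cite: LiebLoss2001, Theorem 1.14] -/
theorem smearing_term_nonneg (μ : ℝ) (k : TorusSite 2 L) (σ : Fin 2)
    (ψ : Fock (Orb (FermionTorus 2 L))) :
    0 ≤ max (μ - torusBand L k) 0 * ((star ψ ⬝ᵥ ψ).re - occ k σ ψ) +
      max (torusBand L k - μ) 0 * occ k σ ψ :=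
  add_nonneg (mul_nonneg (le_max_right _ _) (sub_nonneg.2 (occ_le k σ ψ)))
    (mul_nonneg (le_max_right _ _) (occ_nonneg k σ ψ))

/-- `W_μ(ψ) ≥ 0`. [cite: LiebLoss2001, Theorem 1.14] -/
theorem smearing_nonneg (μ : ℝ) (ψ : Fock (Orb (FermionTorus 2 L))) : 0 ≤ smearing μ ψ :=
  sum_nonneg fun k _ => sum_nonneg fun σ _ => smearing_term_nonneg μ k σ ψ

/-- **Kinetic energy in momentum space**: `Re⟨ψ, H₀ ψ⟩ = Σ_{kσ} ε_L(k) x_{kσ}(ψ)` (`L ≥ 3`).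
[cite: Tasaki2020, §2.1] -/
theorem re_expect_kinetic_eq_sum (hL : 3 ≤ L) (ψ : Fock (Orb (FermionTorus 2 L))) :
    (star ψ ⬝ᵥ (hubbardTorus 2 L 1 0 *ᵥ ψ)).re =
      ∑ k : TorusSite 2 L, ∑ σ : Fin 2, torusBand L k * occ k σ ψ := by
  rw [hubbardTorus_zero_eq_sum_momentumNumber hL, Matrix.sum_mulVec, dotProduct_sum, Complex.re_sum]
  refine sum_congr rfl fun k _ => ?_
  rw [Matrix.sum_mulVec, dotProduct_sum, Complex.re_sum]
  refine sum_congr rfl fun σ _ => ?_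
  rw [Matrix.smul_mulVec, dotProduct_smul, smul_eq_mul, Complex.re_ofReal_mul]
  rfl

/-- **Particle number in momentum space**: `Σ_{kσ} x_{kσ}(ψ) = N ‖ψ‖²` for an `N`-particle `ψ`
(Parseval). [cite: Tasaki2020, §2.1] -/
theorem sum_occ_eq {N : ℕ} {ψ : Fock (Orb (FermionTorus 2 L))} (hψ : IsNParticle N ψ) :
    ∑ k : TorusSite 2 L, ∑ σ : Fin 2, occ k σ ψ = N * (star ψ ⬝ᵥ ψ).re := by
  have h := (LiebTwo.isNParticle_iff_totalNumber N ψ).1 hψ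
  have h2 : star ψ ⬝ᵥ ((∑ k : TorusSite 2 L, ∑ σ : Fin 2, momentumNumber k σ) *ᵥ ψ) =
      (N : ℂ) * (star ψ ⬝ᵥ ψ) := by
    rw [← totalNumber_eq_sum_momentumNumber, h, dotProduct_smul, smul_eq_mul]
  rw [Matrix.sum_mulVec, dotProduct_sum] at h2
  simp_rw [Matrix.sum_mulVec, dotProduct_sum] at h2
  have h3 := congrArg Complex.re h2
  rw [Complex.re_sum, Complex.mul_re, Complex.natCast_re, Complex.natCast_im, zero_mul, sub_zero] at h3
  simp_rw [Complex.re_sum] at h3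
  simpa only [occ] using h3

/-- The pointwise bookkeeping behind the identity:
`(μ-ε)₊ (n - x) + (ε-μ)₊ x = ε x - μ x - min(ε - μ, 0) n`. [cite: LiebLoss2001, Theorem 1.14] -/
theorem term_eq (μ ε n x : ℝ) :
    max (μ - ε) 0 * (n - x) + max (ε - μ) 0 * x = ε * x - μ * x - min (ε - μ) 0 * n := by
  rcases le_total ε μ with h | h
  · rw [max_eq_left (sub_nonneg.2 h), max_eq_right (sub_nonpos.2 h), min_eq_left (sub_nonpos.2 h)]
    ring
  · rw [max_eq_right (sub_nonpos.2 h), max_eq_left (sub_nonneg.2 h), min_eq_right (sub_nonneg.2 h)]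
    ring

/-- **THE IDENTITY**: for `L ≥ 3`, any `μ` and any `N`-particle `ψ`,
`W_μ(ψ) = Re⟨ψ, H₀ ψ⟩ - (μ N + 2 Σ_k min(ε_k - μ, 0)) ‖ψ‖²` — the Fermi-surface smearing is the kinetic
energy above the bathtub value. [cite: LiebLoss2001, Theorem 1.14] -/
theorem smearing_eq (hL : 3 ≤ L) (μ : ℝ) {N : ℕ} {ψ : Fock (Orb (FermionTorus 2 L))}
    (hψ : IsNParticle N ψ) :
    smearing μ ψ = (star ψ ⬝ᵥ (hubbardTorus 2 L 1 0 *ᵥ ψ)).re -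
      (μ * N + 2 * ∑ k : TorusSite 2 L, min (torusBand L k - μ) 0) * (star ψ ⬝ᵥ ψ).re := by
  unfold smearing
  simp_rw [term_eq]
  have hx := sum_occ_eq (L := L) hψ
  have hK := re_expect_kinetic_eq_sum hL ψ
  set n := (star ψ ⬝ᵥ ψ).re with hn
  have hsplit : ∀ k : TorusSite 2 L, ∑ σ : Fin 2,
      (torusBand L k * occ k σ ψ - μ * occ k σ ψ - min (torusBand L k - μ) 0 * n) =
      (∑ σ : Fin 2, torusBand L k * occ k σ ψ) - μ * (∑ σ : Fin 2, occ k σ ψ) -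
        2 * (min (torusBand L k - μ) 0 * n) := by
    intro k
    rw [Fin.sum_univ_two, Fin.sum_univ_two, Fin.sum_univ_two]
    ring
  simp_rw [hsplit]
  rw [Finset.sum_sub_distrib, Finset.sum_sub_distrib, ← Finset.mul_sum, ← Finset.mul_sum, ← hK, hx,
    ← Finset.sum_mul]
  ring

/-- **Markov bound**: for `δ > 0`, sets `Sm` of levels `ε_k ≤ μ - δ` and `Sp` of levels `ε_k ≥ μ + δ`,
`δ · (holes of ψ in Sm + particles of ψ in Sp) ≤ W_μ(ψ)`. [cite: LiebLoss2001, Theorem 1.14] -/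
theorem markov (μ : ℝ) {δ : ℝ} (hδ : 0 < δ) (Sm Sp : Finset (TorusSite 2 L))
    (hSm : ∀ k ∈ Sm, torusBand L k ≤ μ - δ) (hSp : ∀ k ∈ Sp, μ + δ ≤ torusBand L k)
    (ψ : Fock (Orb (FermionTorus 2 L))) :
    δ * ((∑ k ∈ Sm, ∑ σ : Fin 2, ((star ψ ⬝ᵥ ψ).re - occ k σ ψ)) +
        ∑ k ∈ Sp, ∑ σ : Fin 2, occ k σ ψ) ≤ smearing μ ψ := by
  set f : TorusSite 2 L → ℝ := fun k => ∑ σ : Fin 2,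
    (max (μ - torusBand L k) 0 * ((star ψ ⬝ᵥ ψ).re - occ k σ ψ) +
      max (torusBand L k - μ) 0 * occ k σ ψ) with hf
  have hdisj : Disjoint Sm Sp := by
    rw [Finset.disjoint_left]
    intro k hk hk'
    have h1 := hSm k hk
    have h2 := hSp k hk'
    linarith
  have hm : δ * ∑ k ∈ Sm, ∑ σ : Fin 2, ((star ψ ⬝ᵥ ψ).re - occ k σ ψ) ≤ ∑ k ∈ Sm, f k := by
    rw [Finset.mul_sum]
    refine Finset.sum_le_sum fun k hk => ?_
    rw [hf, Finset.mul_sum]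
    refine Finset.sum_le_sum fun σ _ => ?_
    have h1 : δ ≤ max (μ - torusBand L k) 0 := le_trans (by linarith [hSm k hk]) (le_max_left _ _)
    have h2 := sub_nonneg.2 (occ_le k σ ψ)
    have h3 := mul_nonneg (le_max_right (torusBand L k - μ) 0) (occ_nonneg k σ ψ)
    nlinarith
  have hp : δ * ∑ k ∈ Sp, ∑ σ : Fin 2, occ k σ ψ ≤ ∑ k ∈ Sp, f k := by
    rw [Finset.mul_sum]
    refine Finset.sum_le_sum fun k hk => ?_
    rw [hf, Finset.mul_sum]
    refine Finset.sum_le_sum fun σ _ => ?_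
    have h1 : δ ≤ max (torusBand L k - μ) 0 := le_trans (by linarith [hSp k hk]) (le_max_left _ _)
    have h2 := occ_nonneg k σ ψ
    have h3 := mul_nonneg (le_max_right (μ - torusBand L k) 0) (sub_nonneg.2 (occ_le k σ ψ))
    nlinarith
  have hu : ∑ k ∈ Sm, f k + ∑ k ∈ Sp, f k ≤ smearing μ ψ := by
    rw [← Finset.sum_union hdisj]
    exact Finset.sum_le_sum_of_subset_of_nonneg (Finset.subset_univ _)
      fun k _ _ => sum_nonneg fun σ _ => smearing_term_nonneg μ k σ ψ
  rw [mul_add]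
  linarith

/-! ### §2 The `4 × 4` torus at `μ = 0` -/

/-- The band of the `4 × 4` torus in terms of `cosFour`: `ε(k) = -2(cosFour k₀ + cosFour k₁)`.
[cite: Tasaki2020, §2.1] -/
theorem torusBand_four (k : TorusSite 2 4) :
    torusBand 4 k = -2 * (cosFour (k 0).val + cosFour (k 1).val) := by
  rw [torusBand, Fin.sum_univ_two, cos_latticeMomentum_four, cos_latticeMomentum_four]

/-- The sixteen levels of the `4 × 4` torus are `-4, -2, 0, 2, 4`. [cite: Tasaki2020, §2.1] -/
theorem torusBand_four_mem (k : TorusSite 2 4) :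
    torusBand 4 k = -4 ∨ torusBand 4 k = -2 ∨ torusBand 4 k = 0 ∨ torusBand 4 k = 2 ∨
      torusBand 4 k = 4 := by
  rw [torusBand_four]
  have ha : (k 0).val < 4 := ZMod.val_lt (k 0)
  have hb : (k 1).val < 4 := ZMod.val_lt (k 1)
  have hc : cosFour 0 = 1 ∧ cosFour 1 = 0 ∧ cosFour 2 = -1 ∧ cosFour 3 = 0 := ⟨rfl, rfl, rfl, rfl⟩
  generalize (k 0).val = a at ha ⊢
  generalize (k 1).val = b at hb ⊢
  interval_cases a <;> interval_cases b <;>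
    simp only [hc.1, hc.2.1, hc.2.2.1, hc.2.2.2] <;> norm_num

/-- A positive level of the `4 × 4` torus is `≥ 2`. [cite: Tasaki2020, §2.1] -/
theorem two_le_torusBand_four_of_pos {k : TorusSite 2 4} (h : 0 < torusBand 4 k) :
    2 ≤ torusBand 4 k := by
  rcases torusBand_four_mem k with e | e | e | e | e <;> linarith

/-- A negative level of the `4 × 4` torus is `≤ -2`. [cite: Tasaki2020, §2.1] -/
theorem torusBand_four_le_neg_two_of_neg {k : TorusSite 2 4} (h : torusBand 4 k < 0) :
    torusBand 4 k ≤ -2 := by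
  rcases torusBand_four_mem k with e | e | e | e | e <;> linarith

/-- `|ε(k)| ≤ 4` on the `4 × 4` torus. [cite: Tasaki2020, §2.1] -/
theorem abs_torusBand_four_le (k : TorusSite 2 4) : |torusBand 4 k| ≤ 4 := by
  rcases torusBand_four_mem k with e | e | e | e | e <;> rw [e] <;> norm_num

/-- The corner momentum `Q = (π, π)` of the `4 × 4` torus (`k = (2, 2)`). [cite: VarneyEtAl2009, §3] -/
def cornerQ : TorusSite 2 4 := fun _ => 2

/-- `ε(Q) = 4`. [cite: Tasaki2020, §2.1] -/
theorem torusBand_cornerQ : torusBand 4 cornerQ = 4 := by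
  rw [torusBand_four]
  have h2 : ((cornerQ : TorusSite 2 4) 0).val = 2 ∧ ((cornerQ : TorusSite 2 4) 1).val = 2 := ⟨rfl, rfl⟩
  rw [h2.1, h2.2]
  have hc : cosFour 2 = -1 := rfl
  rw [hc]
  norm_num

/-- `ε(Γ) = -4`. [cite: Tasaki2020, §2.1] -/
theorem torusBand_gamma : torusBand 4 (0 : TorusSite 2 4) = -4 := by
  rw [torusBand_four]
  have h0 : ((0 : TorusSite 2 4) 0).val = 0 ∧ ((0 : TorusSite 2 4) 1).val = 0 := ⟨rfl, rfl⟩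
  rw [h0.1, h0.2]
  have hc : cosFour 0 = 1 := rfl
  rw [hc]
  norm_num

/-- **The bathtub value of the `4 × 4` torus at `μ = 0` is `-24`**: `2 Σ_k min(ε_k, 0) = -24`
(levels `-4`, `-2` ×4 below zero). [cite: LiebLoss2001, Theorem 1.14] -/
theorem bathtub_four_zero : 2 * ∑ k : TorusSite 2 4, min (torusBand 4 k - 0) 0 = -24 := by
  set F : ℝ → ℝ → ℝ := fun a b => min (-2 * (a + b) - 0) 0 with hF
  have hs : ∑ k : TorusSite 2 4, min (torusBand 4 k - 0) 0 =
      ∑ ab : Fin 4 × Fin 4, F (cosFour ab.1.val) (cosFour ab.2.val) := by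
    refine Fintype.sum_equiv (piFinTwoEquiv fun _ => ZMod 4) _ _ fun k => ?_
    rw [torusBand_four]
    rfl
  have e11 : F 1 1 = -4 := by simp only [hF]; rw [min_eq_left (by norm_num)]; norm_num
  have e10 : F 1 0 = -2 := by simp only [hF]; rw [min_eq_left (by norm_num)]; norm_num
  have e01 : F 0 1 = -2 := by simp only [hF]; rw [min_eq_left (by norm_num)]; norm_num
  have e1m : F 1 (-1) = 0 := by simp only [hF]; rw [min_eq_right (by norm_num)]
  have em1 : F (-1) 1 = 0 := by simp only [hF]; rw [min_eq_right (by norm_num)]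
  have e00 : F 0 0 = 0 := by simp only [hF]; rw [min_eq_right (by norm_num)]
  have e0m : F 0 (-1) = 0 := by simp only [hF]; rw [min_eq_right (by norm_num)]
  have em0 : F (-1) 0 = 0 := by simp only [hF]; rw [min_eq_right (by norm_num)]
  have emm : F (-1) (-1) = 0 := by simp only [hF]; rw [min_eq_right (by norm_num)]
  have hv : (0 : Fin 4).val = 0 ∧ (1 : Fin 4).val = 1 ∧ (2 : Fin 4).val = 2 ∧ (3 : Fin 4).val = 3 :=
    ⟨rfl, rfl, rfl, rfl⟩
  have hc : cosFour 0 = 1 ∧ cosFour 1 = 0 ∧ cosFour 2 = -1 ∧ cosFour 3 = 0 := ⟨rfl, rfl, rfl, rfl⟩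
  rw [hs, Fintype.sum_prod_type]
  simp only [Fin.sum_univ_four, hv.1, hv.2.1, hv.2.2.1, hv.2.2.2, hc.1, hc.2.1, hc.2.2.1, hc.2.2.2]
  rw [e11, e10, e01, e1m, em1, e00, e0m, em0, emm]
  norm_num

/-- **`W_0(ψ) = Re⟨ψ, H₀ ψ⟩ + 24 ‖ψ‖²` on the `4 × 4` torus** for every `N`-particle `ψ`: the smearing at
the half-filled-shell Fermi level `μ = 0` is the kinetic energy above the free value `-24`.
[cite: LiebLoss2001, Theorem 1.14] -/
theorem smearing_zero_four_eq {N : ℕ} {ψ : Fock (Orb (FermionTorus 2 4))} (hψ : IsNParticle N ψ) :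
    smearing 0 ψ = (star ψ ⬝ᵥ (hubbardTorus 2 4 1 0 *ᵥ ψ)).re + 24 * (star ψ ⬝ᵥ ψ).re := by
  haveI : NeZero (4 : ℕ) := ⟨by norm_num⟩
  rw [smearing_eq (L := 4) (by norm_num) 0 hψ, zero_mul, zero_add, bathtub_four_zero]
  ring

/-- The five levels above the Fermi level `μ = 0` of the `4 × 4` torus (`ε = 2` ×4 and `ε(Q) = 4`).
[cite: VarneyEtAl2009, §3] -/
def above : Finset (TorusSite 2 4) := Finset.univ.filter fun k => 0 < torusBand 4 k

/-- The five levels below the Fermi level `μ = 0` (`ε(Γ) = -4` and `ε = -2` ×4): the closed free Fermi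
sea. [cite: VarneyEtAl2009, §3] -/
def below : Finset (TorusSite 2 4) := Finset.univ.filter fun k => torusBand 4 k < 0

/-- **Electrons above the Fermi level**: `N_> (ψ) = Σ_{ε_k > 0} Σ_σ x_{kσ}(ψ)`. [cite: VarneyEtAl2009, §3] -/
def nAbove (ψ : Fock (Orb (FermionTorus 2 4))) : ℝ := ∑ k ∈ above, ∑ σ : Fin 2, occ k σ ψ

/-- **Holes in the closed Fermi sea**: `H_< (ψ) = Σ_{ε_k < 0} Σ_σ (‖ψ‖² - x_{kσ}(ψ))`.
[cite: VarneyEtAl2009, §3] -/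
def holesBelow (ψ : Fock (Orb (FermionTorus 2 4))) : ℝ :=
  ∑ k ∈ below, ∑ σ : Fin 2, ((star ψ ⬝ᵥ ψ).re - occ k σ ψ)

/-- **Electrons inside the free Fermi sea plus its open shell**: `N_≤ (ψ) = Σ_{ε_k ≤ 0} Σ_σ x_{kσ}(ψ)`
(eleven levels, 22 spin-orbitals). [cite: VarneyEtAl2009, §3] -/
def nInside (ψ : Fock (Orb (FermionTorus 2 4))) : ℝ :=
  ∑ k ∈ Finset.univ.filter (fun k => ¬ 0 < torusBand 4 k), ∑ σ : Fin 2, occ k σ ψ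

/-- `N_≤ + N_> = N ‖ψ‖²`. [cite: VarneyEtAl2009, §3] -/
theorem nInside_add_nAbove {N : ℕ} {ψ : Fock (Orb (FermionTorus 2 4))} (hψ : IsNParticle N ψ) :
    nInside ψ + nAbove ψ = N * (star ψ ⬝ᵥ ψ).re := by
  haveI : NeZero (4 : ℕ) := ⟨by norm_num⟩
  rw [nInside, nAbove, above, add_comm, Finset.sum_filter_add_sum_filter_not, sum_occ_eq hψ]

/-- `0 ≤ N_>`. [cite: VarneyEtAl2009, §3] -/
theorem nAbove_nonneg (ψ : Fock (Orb (FermionTorus 2 4))) : 0 ≤ nAbove ψ :=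
  sum_nonneg fun k _ => sum_nonneg fun σ _ => occ_nonneg k σ ψ

/-- `0 ≤ H_<`. [cite: VarneyEtAl2009, §3] -/
theorem holesBelow_nonneg (ψ : Fock (Orb (FermionTorus 2 4))) : 0 ≤ holesBelow ψ :=
  sum_nonneg fun k _ => sum_nonneg fun σ _ => sub_nonneg.2 (occ_le k σ ψ)

/-- **`2 (H_< + N_>) ≤ W_0`**: every hole below and every particle above the Fermi level sits at distance
`≥ 2` from it. [cite: LiebLoss2001, Theorem 1.14] -/
theorem two_mul_dev_le_smearing_zero (ψ : Fock (Orb (FermionTorus 2 4))) :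
    2 * (holesBelow ψ + nAbove ψ) ≤ smearing 0 ψ := by
  haveI : NeZero (4 : ℕ) := ⟨by norm_num⟩
  refine markov (L := 4) 0 (by norm_num : (0 : ℝ) < 2) below above ?_ ?_ ψ
  · intro k hk
    rw [below, Finset.mem_filter] at hk
    have := torusBand_four_le_neg_two_of_neg hk.2
    linarith
  · intro k hk
    rw [above, Finset.mem_filter] at hk
    have := two_le_torusBand_four_of_pos hk.2
    linarith

/-- **`4 (h_Γ + n_Q) ≤ W_0`**: the holes at `Γ` (`ε = -4`) and the particles at `Q = (π,π)` (`ε = 4`),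
spin-summed, number at most `W_0/4`. [cite: LiebLoss2001, Theorem 1.14] -/
theorem four_mul_corner_le_smearing_zero (ψ : Fock (Orb (FermionTorus 2 4))) :
    4 * ((∑ σ : Fin 2, ((star ψ ⬝ᵥ ψ).re - occ 0 σ ψ)) + ∑ σ : Fin 2, occ cornerQ σ ψ) ≤
      smearing 0 ψ := by
  haveI : NeZero (4 : ℕ) := ⟨by norm_num⟩
  have h := markov (L := 4) 0 (by norm_num : (0 : ℝ) < 4) {0} {cornerQ}
    (fun k hk => by rw [Finset.mem_singleton] at hk; rw [hk, torusBand_gamma]; norm_num)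
    (fun k hk => by rw [Finset.mem_singleton] at hk; rw [hk, torusBand_cornerQ]; norm_num) ψ
  simpa only [Finset.sum_singleton] using h

/-- **`W_0 ≤ 4 (H_< + N_>)`**: every level is within `4` of the Fermi level, so the smearing is at most
four times the number of displaced electrons. [cite: LiebLoss2001, Theorem 1.14] -/
theorem smearing_zero_le_four_mul_dev (ψ : Fock (Orb (FermionTorus 2 4))) :
    smearing 0 ψ ≤ 4 * (holesBelow ψ + nAbove ψ) := by
  haveI : NeZero (4 : ℕ) := ⟨by norm_num⟩
  have hpt : ∀ k : TorusSite 2 4, ∀ σ : Fin 2,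
      max (0 - torusBand 4 k) 0 * ((star ψ ⬝ᵥ ψ).re - occ k σ ψ) + max (torusBand 4 k - 0) 0 * occ k σ ψ ≤
        4 * ((if torusBand 4 k < 0 then (star ψ ⬝ᵥ ψ).re - occ k σ ψ else 0) +
          (if 0 < torusBand 4 k then occ k σ ψ else 0)) := by
    intro k σ
    have h0 := occ_nonneg k σ ψ
    have h1 := sub_nonneg.2 (occ_le k σ ψ)
    rcases torusBand_four_mem k with e | e | e | e | e <;> rw [e] <;> norm_num <;> nlinarith
  calc smearing 0 ψ
      ≤ ∑ k : TorusSite 2 4, ∑ σ : Fin 2, 4 * ((if torusBand 4 k < 0 then (star ψ ⬝ᵥ ψ).re - occ k σ ψ else 0) +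
          (if 0 < torusBand 4 k then occ k σ ψ else 0)) :=
        Finset.sum_le_sum fun k _ => Finset.sum_le_sum fun σ _ => hpt k σ
    _ = 4 * (holesBelow ψ + nAbove ψ) := by
        rw [holesBelow, nAbove, below, above, Finset.sum_filter, Finset.sum_filter]
        simp_rw [mul_add, Finset.sum_add_distrib, ← Finset.mul_sum]
        congr 1 <;> congr 1 <;> refine Finset.sum_congr rfl fun k _ => ?_ <;> split_ifs <;> simp

end Literature.MathematicalPhysics.QuantumLattice.FermiSmearing

end
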